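import Summits.Schanuel.Schanuel.Theorems.RootDecomp1KTorsionHeights

/-!
# RootDecomp1KTorsionEndgame — §21 REV C «TORSION CELLS» port, part 3/5 (lens 6, gen 10 = ROUND 5 theorem round of route-Schanuel-RootDecomp1K on A₄ʰ stmt-Schanuel-33363)

Mechanical port (census-1 gen 8; tools tools/build_dark.py over census/tools/gen7/portkit2.py) of §21 of HOME/decomp-schanuel-lens-6/g10/addendum/TorsionCells.lean v2 (= scratch/Tor21.lean without its copied toolkit)
(sha256 b430567a…, 9025 l; critic VERDICT 2026-08-30T16:25:54Z ACCEPTED — amended F2⁗-1K (i) MET by the sub-class «torsion anchor»; census C-6) on top of the §17 wave Theorems/RootDecomp1KHyper01…19.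
This part: node lines 8406–8545 (6 declarations: eta_lt_delta, log_four_le_two, log_Lambda_le, exponent_le, upper_exp, torEndgame).
No named fact, no hypothesis (only tree-proved inputs);
statements and proofs
are otherwise the node's verbatim, in the wave namespace `Summit.Schanuel.Schanuel.Theorems.RootDecomp1KHyper` (sub-namespace `HyperCell`).
`--supports stmt-Schanuel-33363` (A₄ʰ HyperLiouvilleSchanuel: HYPOTHESIS-FREE decided n = 3 cells (2πi, ρ·2πi, w) and every torsion anchor s·πi (ρ hyper-Liouville), via algebraicIndependent_torsion — only input the tree-proved NW96 Thm 2(2) measure of π). Sorry-free; standard axioms. Nothing here proves Schanuel; rung 0.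
-/

set_option linter.dupNamespace false
set_option linter.unusedSectionVars false

noncomputable section

open Complex IntermediateField Filter Polynomial

namespace Summit.Schanuel.Schanuel.Theorems.RootDecomp1KHyper

variable {n K : ℕ}

namespace HyperCell

variable {n K : ℕ}

/-- §21j. Elementary exponential bounds: auxiliary statement `log_le_self_of_pos` (lens 6 gen 10 node, ported verbatim). -/
private theorem log_le_self_of_pos {x : ℝ} (hx : 0 < x) : Real.log x ≤ x := by
  linarith [Real.log_le_sub_one_of_pos hx]

/-- §21j. Elementary exponential bounds: auxiliary statement `self_le_exp` (lens 6 gen 10 node, ported verbatim). -/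
private theorem self_le_exp (x : ℝ) : x ≤ Real.exp x := by linarith [Real.add_one_le_exp x]

/-- §21k. Pure real-number lemmas of the endgame (kept out of the big context): auxiliary statement `eta_lt_delta` (lens 6 gen 10 node, ported verbatim). -/
theorem eta_lt_delta {Q δ₁ η : ℝ} (hQ1 : 1 ≤ Q) (hδ₁ : 0 < δ₁) (hc : (⌈1 / δ₁⌉₊ : ℝ) + 1 ≤ Q)
    (hη : η < Real.exp (-(Q ^ 7))) : η < δ₁ := by
  have hQ0 : 0 < Q := by linarith
  have h1 : Real.exp (-(Q ^ 7)) ≤ Real.exp (-Q) := by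
    refine Real.exp_le_exp.mpr ?_
    rw [neg_le_neg_iff]
    calc Q = Q ^ 1 := (pow_one Q).symm
      _ ≤ Q ^ 7 := pow_le_pow_right₀ hQ1 (by norm_num)
  have h2 : Real.exp (-Q) < 1 / Q := by
    rw [Real.exp_neg, lt_div_iff₀ hQ0]
    have hQe : Q < Real.exp Q := by linarith [Real.add_one_le_exp Q]
    have := mul_lt_mul_of_pos_left hQe (inv_pos.mpr (Real.exp_pos Q))
    rwa [inv_mul_cancel₀ (Real.exp_pos Q).ne'] at this
  have h3 : 1 / Q ≤ δ₁ := by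
    have hc' : 1 / δ₁ ≤ Q := le_trans (Nat.le_ceil _) (by linarith)
    rw [div_le_iff₀ hQ0]
    rw [div_le_iff₀ hδ₁] at hc'
    linarith
  linarith

/-- §21k. Pure real-number lemmas of the endgame (kept out of the big context): auxiliary statement `log_four_le_two` (lens 6 gen 10 node, ported verbatim). -/
private theorem log_four_le_two : Real.log 4 ≤ 2 := by
  have h4 : Real.log 4 = 2 * Real.log 2 := by
    rw [show (4 : ℝ) = 2 ^ 2 by norm_num, Real.log_pow]; ring
  rw [h4]; linarith [Real.log_two_lt_d9]

/-- §21k. Pure real-number lemmas of the endgame (kept out of the big context): auxiliary statement `log_Lambda_le` (lens 6 gen 10 node, ported verbatim). -/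
theorem log_Lambda_le {Q A K D d : ℝ} (hQ1 : 1 ≤ Q) (hA1 : 1 ≤ A) (hK0 : 0 ≤ K) (hD0 : 0 ≤ D)
    (hd0 : 0 ≤ d) (hdQ : d ≤ (K + 1) * Q) {n Dn dn : ℕ} (hn : (n : ℝ) = Q) (hDn : (Dn : ℝ) = D)
    (hdn : (dn : ℝ) = d) :
    Real.log (2 ^ dn * (A * Q ^ Dn) ^ n + 3) ≤ (2 + (K + 1) + A + D) * Q ^ 2 := by
  have hQ0 : 0 < Q := by linarith
  have hA0 : 0 < A := by linarith
  have hAQ1 : 1 ≤ A * Q ^ Dn := one_le_mul_of_one_le_of_one_le hA1 (one_le_pow₀ hQ1)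
  have hW1 : (1 : ℝ) ≤ 2 ^ dn * (A * Q ^ Dn) ^ n :=
    one_le_mul_of_one_le_of_one_le (one_le_pow₀ (by norm_num)) (one_le_pow₀ hAQ1)
  have hΛ4 : 2 ^ dn * (A * Q ^ Dn) ^ n + 3 ≤ 4 * (2 ^ dn * (A * Q ^ Dn) ^ n) := by linarith
  have hΛ0 : (0 : ℝ) < 2 ^ dn * (A * Q ^ Dn) ^ n + 3 := by positivity
  have h1 : Real.log (2 ^ dn * (A * Q ^ Dn) ^ n + 3) ≤
      Real.log 4 + (dn * Real.log 2 + n * (Real.log A + Dn * Real.log Q)) := by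
    calc Real.log (2 ^ dn * (A * Q ^ Dn) ^ n + 3) ≤ Real.log (4 * (2 ^ dn * (A * Q ^ Dn) ^ n)) :=
          Real.log_le_log hΛ0 hΛ4
      _ = Real.log 4 + (dn * Real.log 2 + n * (Real.log A + Dn * Real.log Q)) := by
          rw [Real.log_mul (by norm_num) (by positivity),
            Real.log_mul (by positivity) (by positivity), Real.log_pow, Real.log_pow,
            Real.log_mul (by positivity) (by positivity), Real.log_pow]
  rw [hn, hDn, hdn] at h1
  have hlog2 : Real.log 2 ≤ 1 := by linarith [Real.log_two_lt_d9]
  have hlogA : Real.log A ≤ A := log_le_self_of_pos hA0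
  have hlogQ : Real.log Q ≤ Q := log_le_self_of_pos hQ0
  have hQQ : Q ≤ Q ^ 2 := by nlinarith
  have h2 : d * Real.log 2 ≤ (K + 1) * Q ^ 2 := by
    calc d * Real.log 2 ≤ d * 1 := mul_le_mul_of_nonneg_left hlog2 hd0
      _ ≤ (K + 1) * Q := by linarith
      _ ≤ (K + 1) * Q ^ 2 := mul_le_mul_of_nonneg_left hQQ (by linarith)
  have h3 : Q * (Real.log A + D * Real.log Q) ≤ A * Q ^ 2 + D * Q ^ 2 := by
    have h31 : Real.log A + D * Real.log Q ≤ A + D * Q := by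
      have := mul_le_mul_of_nonneg_left hlogQ hD0; linarith
    calc Q * (Real.log A + D * Real.log Q) ≤ Q * (A + D * Q) :=
          mul_le_mul_of_nonneg_left h31 hQ0.le
      _ = A * Q + D * Q ^ 2 := by ring
      _ ≤ A * Q ^ 2 + D * Q ^ 2 := by
          have := mul_le_mul_of_nonneg_left hQQ hA0.le; linarith
  have h4 : Real.log 4 ≤ 2 * Q ^ 2 := by
    have : (1 : ℝ) ≤ Q ^ 2 := by nlinarith
    linarith [log_four_le_two]
  calc Real.log (2 ^ dn * (A * Q ^ Dn) ^ n + 3)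
      ≤ Real.log 4 + (d * Real.log 2 + Q * (Real.log A + D * Real.log Q)) := h1
    _ ≤ 2 * Q ^ 2 + ((K + 1) * Q ^ 2 + (A * Q ^ 2 + D * Q ^ 2)) := by linarith
    _ = (2 + (K + 1) + A + D) * Q ^ 2 := by ring

/-- §21k. Pure real-number lemmas of the endgame (kept out of the big context): auxiliary statement `exponent_le` (lens 6 gen 10 node, ported verbatim). -/
theorem exponent_le {Q K d LΛ A₂ : ℝ} (hQ1 : 1 ≤ Q) (hK0 : 0 ≤ K) (hd1 : 1 ≤ d)
    (hdQ : d ≤ (K + 1) * Q) (hA₂ : 0 ≤ A₂) (hLΛ0 : 0 ≤ LΛ) (hLΛ : LΛ ≤ A₂ * Q ^ 2) :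
    2 * 10 ^ 6 * d * (LΛ + d * Real.log d) * (1 + Real.log d) ≤
      (4 * 10 ^ 6 * (K + 1) ^ 2 * (A₂ + (K + 1) ^ 2)) * Q ^ 4 := by
  have hd0 : 0 < d := by linarith
  have hlogd : Real.log d ≤ d := log_le_self_of_pos hd0
  have hlogd0 : 0 ≤ Real.log d := Real.log_nonneg hd1
  have h1 : 1 + Real.log d ≤ 2 * ((K + 1) * Q) := by linarith
  have h2 : d * Real.log d ≤ ((K + 1) * Q) ^ 2 := by
    calc d * Real.log d ≤ d * d := mul_le_mul_of_nonneg_left hlogd hd0.le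
      _ ≤ ((K + 1) * Q) ^ 2 := by rw [sq]; exact mul_le_mul hdQ hdQ hd0.le (by positivity)
  have h3 : LΛ + d * Real.log d ≤ (A₂ + (K + 1) ^ 2) * Q ^ 2 := by nlinarith
  have hpos1 : 0 ≤ LΛ + d * Real.log d := by positivity
  calc 2 * 10 ^ 6 * d * (LΛ + d * Real.log d) * (1 + Real.log d)
      ≤ 2 * 10 ^ 6 * ((K + 1) * Q) * ((A₂ + (K + 1) ^ 2) * Q ^ 2) * (2 * ((K + 1) * Q)) := by
        gcongr
    _ = (4 * 10 ^ 6 * (K + 1) ^ 2 * (A₂ + (K + 1) ^ 2)) * Q ^ 4 := by ring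

/-- §21k. Pure real-number lemmas of the endgame (kept out of the big context): auxiliary statement `upper_exp` (lens 6 gen 10 node, ported verbatim). -/
theorem upper_exp {Q B' Kl η : ℝ} {D n : ℕ} (hn : (n : ℝ) = Q) (hQ1 : 1 ≤ Q) (hB'1 : 1 ≤ B')
    (hKl0 : 0 ≤ Kl) (hη0 : 0 ≤ η) :
    (Q ^ D * B') ^ n * (Q ^ D * (Kl * η)) ≤ Real.exp ((2 * D + B' + Kl + 1) * Q ^ 2) * η := by
  have h1 : Q ^ D ≤ Real.exp (D * Q) := pow_le_exp_mul hQ1 D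
  have h2 : B' ≤ Real.exp B' := self_le_exp B'
  have h3 : Q ^ D * B' ≤ Real.exp (D * Q + B') := by
    rw [Real.exp_add]; exact mul_le_mul h1 h2 (by linarith) (Real.exp_pos _).le
  have h4 : (Q ^ D * B') ^ n ≤ Real.exp (Q * (D * Q + B')) := by
    calc (Q ^ D * B') ^ n ≤ (Real.exp (D * Q + B')) ^ n :=
          pow_le_pow_left₀ (by positivity) h3 _
      _ = Real.exp (Q * (D * Q + B')) := by rw [← Real.exp_nat_mul, hn]
  have h5 : Kl ≤ Real.exp Kl := self_le_exp Kl
  have h6 : Q ^ D * (Kl * η) ≤ (Real.exp (D * Q) * Real.exp Kl) * η := by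
    rw [← mul_assoc]
    exact mul_le_mul_of_nonneg_right (mul_le_mul h1 h5 hKl0 (Real.exp_pos _).le) hη0
  have h7 : Q * (D * Q + B') + (D * Q + Kl) ≤ (2 * D + B' + Kl + 1) * Q ^ 2 := by
    have hQQ : Q ≤ Q ^ 2 := by nlinarith
    have h1Q : (1 : ℝ) ≤ Q ^ 2 := by nlinarith
    have hD0 : (0 : ℝ) ≤ D := Nat.cast_nonneg D
    have e : (2 * D + B' + Kl + 1) * Q ^ 2 =
        D * Q ^ 2 + B' * Q ^ 2 + (D * Q ^ 2 + Kl * Q ^ 2) + Q ^ 2 := by ring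
    rw [e]
    have a1 : Q * (D * Q + B') = D * Q ^ 2 + B' * Q := by ring
    rw [a1]
    have b1 : B' * Q ≤ B' * Q ^ 2 := mul_le_mul_of_nonneg_left hQQ (by linarith)
    have b2 : D * Q ≤ D * Q ^ 2 := mul_le_mul_of_nonneg_left hQQ hD0
    have b3 : Kl ≤ Kl * Q ^ 2 := by
      have := mul_le_mul_of_nonneg_left h1Q hKl0; linarith
    linarith
  have hexp : Real.exp (Q * (D * Q + B')) * (Real.exp (D * Q) * Real.exp Kl) =
      Real.exp (Q * (D * Q + B') + (D * Q + Kl)) := by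
    rw [Real.exp_add, Real.exp_add]
  calc (Q ^ D * B') ^ n * (Q ^ D * (Kl * η))
      ≤ Real.exp (Q * (D * Q + B')) * ((Real.exp (D * Q) * Real.exp Kl) * η) :=
        mul_le_mul h4 h6 (by positivity) (Real.exp_pos _).le
    _ = Real.exp (Q * (D * Q + B') + (D * Q + Kl)) * η := by rw [← hexp]; ring
    _ ≤ Real.exp ((2 * D + B' + Kl + 1) * Q ^ 2) * η :=
        mul_le_mul_of_nonneg_right (Real.exp_le_exp.mpr h7) hη0

/-- §21k. Pure real-number lemmas of the endgame (kept out of the big context): auxiliary statement `torEndgame` (lens 6 gen 10 node, ported verbatim). -/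
theorem torEndgame {Q A₁ A₃ : ℝ} (hQ1 : 1 ≤ Q) (hA₁ : 0 ≤ A₁) (_hA₃ : 0 ≤ A₃)
    (hQA : A₁ + A₃ + 1 ≤ Q) (h : -(A₃ * Q ^ 4) < A₁ * Q ^ 2 + -(Q ^ 7)) : False := by
  have hQ0 : 0 < Q := by linarith
  have hQ2 : Q ^ 2 ≤ Q ^ 4 := pow_le_pow_right₀ hQ1 (by norm_num)
  have hQ4 : 0 < Q ^ 4 := by positivity
  have h1 : Q ^ 7 < (A₁ + A₃) * Q ^ 4 := by
    have := mul_le_mul_of_nonneg_left hQ2 hA₁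
    linarith
  have h2 : (A₁ + A₃) * Q ^ 4 < Q * Q ^ 4 := by
    apply mul_lt_mul_of_pos_right _ hQ4; linarith
  have h3 : Q * Q ^ 4 ≤ Q ^ 7 := by
    calc Q * Q ^ 4 = Q ^ 5 := by ring
      _ ≤ Q ^ 7 := pow_le_pow_right₀ hQ1 (by norm_num)
  linarith

end HyperCell

end Summit.Schanuel.Schanuel.Theorems.RootDecomp1KHyper
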